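import Literature.Analysis.FunctionSpaces.TorusTrilinearH1
import Literature.Analysis.FunctionSpaces.TorusEnstrophyTrilinear
import HarnessLib

/-!
# The self-convection term `(v·∇)v` in `L²` and `∫ |∇v|⁴` by `‖Δv‖₂⁴` on the flat torus

Function-space support file (all results proved; no definitions, no named facts): two spatial
estimates for smooth vector fields on `T^d`, the quadratic-source bounds of the linearisation
theory of classical Navier–Stokes solutions (`TorusClassicalNSLinearisation`,
`TorusClassicalNSLinearisationH1`: the remainder `u₂ − u₁ − S'(t,u₁)(u₂ − u₁)(a)` solves the
linearised equation with the source `−(δ·∇)δ`, `δ = u₂ − u₁`, whose `L²` size must be quadratic in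
the size of `δ`):

* `Torus.integral_norm_sq_convect_self_le` — `∫ ‖(v·∇)v‖² ≤ (∫‖v‖⁴)^{1/2} (∫(∑ᵢ‖∂ᵢv‖²)²)^{1/2}`
  (any dimension; Cauchy–Schwarz in `ℝ^d` and in `L²`);
* `Torus.exists_integral_sum_norm_partialDeriv_sq_sq_le` — on `T³` (`card d = 3`):
  `∫ (∑ᵢ‖∂ᵢv‖²)² ≤ K_G (∫‖Δv‖²)²`, i.e. `‖∇v‖⁴_{L⁴} ≤ K_G ‖Δv‖₂⁴` (Ladyzhenskaya
  `∫‖∂ᵢv‖⁴ ≤ K ‖∇∂ᵢv‖₂⁴` for the zero-mean smooth fields `∂ᵢv`,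
  `Torus.integral_norm_pow_four_le_gradNormSq_sq`, and `∑ᵢ ‖∇∂ᵢv‖₂² = ‖Δv‖₂²`,
  `Torus.sum_gradNormSq_partialDeriv_eq`); the interpolated sharper form
  `∫ |∇v|⁴ ≤ K ‖∇v‖₂ ‖Δv‖₂³` is `Torus.integral_sum_norm_sq_partialDeriv_sq_le`
  (`TorusEnstrophyTrilinear`), the present polynomial form being the one convenient for Lyapunov
  combinations.

## Mathlib / tree search

Tree (`lean search 'convect_self.*sq_le|partialDeriv_sq_sq_le'`): the interpolated
`Torus.integral_sum_norm_sq_partialDeriv_sq_le` only; reused: `Torus.fderiv_apply_eq_sum_partialDeriv`,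
`Torus.integral_mul_le_sqrt_mul_sqrt_of_continuous` (`TorusTrilinearH1`),
`Torus.integral_norm_pow_four_le_gradNormSq_sq`, `Torus.sum_gradNormSq_partialDeriv_eq`,
`Torus.integral_partialDeriv_eq_zero_holds`. Mathlib: `Real.sum_mul_le_sqrt_mul_sqrt`,
`EuclideanSpace.norm_eq`, `sq_sum_le_card_mul_sum_sq`, `Finset.sum_sq_le_sq_sum_of_nonneg`.

## References

* C. Foias, O. Manley, R. Rosa, R. Temam, *Navier–Stokes Equations and Turbulence*, CUP 2001,
  Ch. II App. A, (A.27) (Ladyzhenskaya / Sobolev inequalities on the torus).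
  [`FoiasManleyRosaTemam2001`]
* P. Constantin, C. Foias, *Navier–Stokes Equations*, Univ. Chicago Press 1988, Ch. 14,
  Lemma 14.3 (the quadratic source of the remainder equation). [`ConstantinFoiasNSE1988`]
-/

open MeasureTheory Set Filter
open scoped InnerProductSpace ContDiff Topology

noncomputable section

namespace Literature.Analysis.FunctionSpaces

namespace Torus

variable {d : Type*} [Fintype d] [DecidableEq d]

/-- **The self-convection term in `L²` by `L⁴` norms**: for a smooth `v : T^d → ℝ^d`,
`∫ ‖(v·∇)v‖² ≤ (∫‖v‖⁴)^{1/2} (∫ (∑ᵢ‖∂ᵢv‖²)²)^{1/2}` (`‖(v·∇)v‖ ≤ ‖v‖(∑ᵢ‖∂ᵢv‖²)^{1/2}`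
pointwise by Cauchy–Schwarz in `ℝ^d`, then Cauchy–Schwarz in `L²`). [folklore] -/
theorem integral_norm_sq_convect_self_le {v : UnitAddTorus d → EuclideanSpace ℝ d}
    (hv : IsSmooth v) :
    ∫ x, ‖convect v v x‖ ^ 2 ≤ Real.sqrt (∫ x, ‖v x‖ ^ 4) *
      Real.sqrt (∫ x, (∑ i, ‖partialDeriv i v x‖ ^ 2) ^ 2) := by
  have hv1 : IsContDiff 1 v := hv.isContDiff (by simp)
  have hpt : ∀ x, ‖convect v v x‖ ^ 2 ≤ ‖v x‖ ^ 2 * ∑ i, ‖partialDeriv i v x‖ ^ 2 := by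
    intro x
    have hS0 : 0 ≤ ∑ i, ‖partialDeriv i v x‖ ^ 2 := Finset.sum_nonneg fun i _ => sq_nonneg _
    have hconv : convect v v x = ∑ i, v x i • partialDeriv i v x :=
      fderiv_apply_eq_sum_partialDeriv hv1 x (v x)
    have h1 : ‖convect v v x‖ ≤ ‖v x‖ * Real.sqrt (∑ i, ‖partialDeriv i v x‖ ^ 2) := by
      rw [hconv, EuclideanSpace.norm_eq (v x)]
      calc ‖∑ i, v x i • partialDeriv i v x‖ ≤ ∑ i, ‖v x i‖ * ‖partialDeriv i v x‖ :=
            (norm_sum_le _ _).trans (le_of_eq (Finset.sum_congr rfl fun i _ => norm_smul _ _))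
        _ ≤ Real.sqrt (∑ i, ‖v x i‖ ^ 2) * Real.sqrt (∑ i, ‖partialDeriv i v x‖ ^ 2) :=
            Real.sum_mul_le_sqrt_mul_sqrt _ _ _
    calc ‖convect v v x‖ ^ 2 ≤ (‖v x‖ * Real.sqrt (∑ i, ‖partialDeriv i v x‖ ^ 2)) ^ 2 :=
          pow_le_pow_left₀ (norm_nonneg _) h1 2
      _ = ‖v x‖ ^ 2 * ∑ i, ‖partialDeriv i v x‖ ^ 2 := by rw [mul_pow, Real.sq_sqrt hS0]
  have hcf : Continuous fun x => ‖v x‖ ^ 2 := hv.continuous.norm.pow 2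
  have hcg : Continuous fun x => ∑ i, ‖partialDeriv i v x‖ ^ 2 :=
    continuous_finsetSum _ fun i _ => (hv.partialDeriv i).continuous.norm.pow 2
  have hCS := integral_mul_le_sqrt_mul_sqrt_of_continuous hcf hcg (fun x => sq_nonneg _)
    fun x => Finset.sum_nonneg fun i _ => sq_nonneg _
  have h4 : ∫ x, (‖v x‖ ^ 2) ^ 2 = ∫ x, ‖v x‖ ^ 4 :=
    integral_congr_ae (ae_of_all _ fun x => by ring)
  rw [h4] at hCS
  exact (integral_mono ((hv.convect hv).norm_sq).integrable (hcf.mul hcg).integrable_unitAddTorus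
    hpt).trans hCS

/-- **`∫ |∇v|⁴` by `‖Δv‖₂⁴` on `T³`.** On `T^d` with `card d = 3` there is `K_G ≥ 0` with
`∫ (∑ᵢ‖∂ᵢv‖²)² ≤ K_G (∫‖Δv‖²)²` for every smooth `v : T^d → ℝ^d`: `(∑ᵢcᵢ)² ≤ d∑ᵢcᵢ²`,
Ladyzhenskaya `∫‖∂ᵢv‖⁴ ≤ K (‖∇∂ᵢv‖₂²)²` for the zero-mean smooth fields `∂ᵢv`
(`Torus.integral_norm_pow_four_le_gradNormSq_sq`, `Torus.integral_partialDeriv_eq_zero_holds`),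
`∑ᵢ xᵢ² ≤ (∑ᵢ xᵢ)²` and `∑ᵢ ‖∇∂ᵢv‖₂² = ‖Δv‖₂²` (`Torus.sum_gradNormSq_partialDeriv_eq`); cf. the
interpolated form `Torus.integral_sum_norm_sq_partialDeriv_sq_le`. [folklore] -/
theorem exists_integral_sum_norm_partialDeriv_sq_sq_le (hd : Fintype.card d = 3) :
    ∃ K : ℝ, 0 ≤ K ∧ ∀ v : UnitAddTorus d → EuclideanSpace ℝ d, IsSmooth v →
      ∫ x, (∑ i, ‖partialDeriv i v x‖ ^ 2) ^ 2 ≤ K * (∫ x, ‖laplacian v x‖ ^ 2) ^ 2 := by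
  obtain ⟨KL, hKL0, hKL⟩ := integral_norm_pow_four_le_gradNormSq_sq (d := d) hd
  refine ⟨Fintype.card d * KL, by positivity, fun v hv => ?_⟩
  have hDs : ∀ i, IsSmooth (partialDeriv i v) := fun i => hv.partialDeriv i
  have hpt : ∀ x, (∑ i, ‖partialDeriv i v x‖ ^ 2) ^ 2 ≤
      Fintype.card d * ∑ i, ‖partialDeriv i v x‖ ^ 4 := fun x => by
    have h := sq_sum_le_card_mul_sum_sq (s := (Finset.univ : Finset d))
      (f := fun i => ‖partialDeriv i v x‖ ^ 2)
    rw [Finset.card_univ] at h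
    refine h.trans (le_of_eq ?_)
    congr 1
    exact Finset.sum_congr rfl fun i _ => by ring
  have hc2 : Continuous fun x => (∑ i, ‖partialDeriv i v x‖ ^ 2) ^ 2 :=
    (continuous_finsetSum _ fun i _ => (hDs i).continuous.norm.pow 2).pow 2
  have hc4 : ∀ i, Continuous fun x => ‖partialDeriv i v x‖ ^ 4 := fun i =>
    (hDs i).continuous.norm.pow 4
  have hLad : ∀ i, ∫ x, ‖partialDeriv i v x‖ ^ 4 ≤ KL * gradNormSq (partialDeriv i v) ^ 2 :=
    fun i => hKL _ (hDs i) (integral_partialDeriv_eq_zero_holds hv i)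
  have hG0 : ∀ i, 0 ≤ gradNormSq (partialDeriv i v) := fun i => gradNormSq_nonneg _
  calc ∫ x, (∑ i, ‖partialDeriv i v x‖ ^ 2) ^ 2
      ≤ ∫ x, (Fintype.card d : ℝ) * ∑ i, ‖partialDeriv i v x‖ ^ 4 :=
        integral_mono hc2.integrable_unitAddTorus
          ((continuous_finsetSum _ fun i _ => hc4 i).integrable_unitAddTorus.const_mul _) hpt
    _ = Fintype.card d * ∑ i, ∫ x, ‖partialDeriv i v x‖ ^ 4 := by
        rw [integral_const_mul, integral_finsetSum _ fun i _ => (hc4 i).integrable_unitAddTorus]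
    _ ≤ Fintype.card d * ∑ i, KL * gradNormSq (partialDeriv i v) ^ 2 := by
        gcongr with i
        exact hLad i
    _ = Fintype.card d * KL * ∑ i, gradNormSq (partialDeriv i v) ^ 2 := by
        rw [← Finset.mul_sum]; ring
    _ ≤ Fintype.card d * KL * (∑ i, gradNormSq (partialDeriv i v)) ^ 2 := by
        gcongr
        exact Finset.sum_sq_le_sq_sum_of_nonneg fun i _ => hG0 i
    _ = Fintype.card d * KL * (∫ x, ‖laplacian v x‖ ^ 2) ^ 2 := by
        rw [sum_gradNormSq_partialDeriv_eq hv]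


end Torus

end Literature.Analysis.FunctionSpaces
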